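import Literature.NumberTheory.Sieve.VinogradovExpSumTools
import Literature.NumberTheory.Sieve.VaughanMeanValueDecomposition
import HarnessLib

/-!
# Vinogradov's estimate for exponential sums over primes (Nathanson, GTM 164, Theorem 8.5)

A complete proof of **Vinogradov's bound**
`|∑_{p ≤ N} (log p) e(pα)| ≤ C (N q^{-1/2} + N^{4/5} + N^{1/2} q^{1/2}) (log N)⁴`
for `N ≥ 2`, `1 ≤ q ≤ N`, `(a, q) = 1`, `|α - a/q| ≤ q⁻²`, with the absolute constant `C = 1552`
(`vinogradov_primeExpSumLog_bound`), following M. B. Nathanson, *Additive Number Theory: the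
Classical Bases*, GTM 164 (1996), §8.5, Theorem 8.5 (p. 220) and Lemmas 8.5–8.8 [Nathanson1996],
i.e. Vaughan's proof. This is exactly the statement of the named fact
`Literature.NumberTheory.Sieve.MontgomeryVaughan1975.vinogradov_expSum_bound`
(`Literature/NumberTheory/Sieve/MontgomeryVaughan1975.lean`), the input LEMMA 3.1 of
H. L. Montgomery, R. C. Vaughan, *The exceptional set in Goldbach's problem*, Acta Arith. 27
(1975), 353–370 [MontgomeryVaughanActa1975]; the one-line discharge lives next to that fact's
users (`MontgomeryVaughan1975MinorArcs.lean`). This file imports the circle-method objects of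
`CircleMethod.lean` (`Literature.NumberTheory.Sieve.primeExpSum`, `Literature.NumberTheory.Sieve.primeExpSumLog`, the truncations `Literature.NumberTheory.Sieve.moebiusTrunc`,
`Literature.NumberTheory.Sieve.vonMangoldtTrunc`, the proved Vaughan identity), the coefficient functions
`c_u = μ_u * Λ_u`, `G_u = (μ - μ_u) * 1`, `F_u = Λ - Λ_u` and the regrouped identity
`Literature.NumberTheory.Sieve.Vaughan.vonMangoldt_eq_four_terms` together with the divisor mean square
`Literature.NumberTheory.Sieve.Vaughan.sum_sq_card_divisors_le` of `VaughanMeanValueDecomposition.lean` (shared with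
the proof of Vaughan's mean value theorem), and the tools of `VinogradovExpSumTools.lean`.

## The proof (Nathanson §8.5, with explicit constants)

* `primeExpSum_eq_vaughan` (Lemma 8.5): summing Vaughan's identity
  `Λ = Λ_u + μ_u * log - c_u * 1 + G_u * F_u` against `e(nα)` gives
  `S(α) = ∑_{n ≤ N} Λ(n) e(nα) = T₀ + S₁ - S₂ + S₄` (`S₄ = -S₃` in Nathanson's notation).
* `norm_afExpSum_vonMangoldtTrunc_le`: `|T₀| ≤ ψ(u)`.
* `norm_S1_le` (Lemma 8.6): `|S₁| ≤ 8 log N (N/q + u + q)(1 + log (qu))`, by partial summation of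
  the weights `log r` and Lemma 4.10.
* `norm_S2_le` (Lemma 8.7): `|S₂| ≤ 4 log N (N/q + u² + q)(1 + log (qu²))`.
* `typeII_sum_norm_sq_le`, `typeII_block_le`, `norm_S4_le` (Lemma 8.8): dyadic blocks
  `(u2^i, u2^{i+1}]`, Cauchy–Schwarz with `∑ d(k)² ≤ x(1 + log x)³` (Theorem A.14) and the mean
  square `∑_{K<k≤2K} |∑_{ℓ ≤ N/k} F_u(ℓ) e(αkℓ)|² ≤ (log N)² (N + 8(N/K)(N/q + N/K + q)(1 + log qN))`
  (the diagonal `ℓ = m` is kept, which the book's display omits; it is harmless), giving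
  `|S₄| ≤ 256 (log N)⁴ (N/√q + 2N/√u + √N √q)`.
* `norm_primeExpSum_le_of_param`: `|S(α)| ≤ 512 (log N)⁴ (N/√q + √N√q + u² + N/√u)` for any
  `1 ≤ u ≤ N`; `norm_primeExpSum_le`: the choice `u = ⌊N^{2/5}⌋` gives
  `|S(α)| ≤ 1536 (N/√q + N^{4/5} + √N√q)(log N)⁴`; finally the prime powers cost
  `ψ(N) - θ(N) ≤ 2 √N log N` (Mathlib's Chebyshev file), whence `vinogradov_primeExpSumLog_bound`.

No statement in this file is a named fact; everything is proved (axioms: propext, choice,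
Quot.sound).
-/

noncomputable section

open Finset Real ArithmeticFunction
open scoped FourierTransform ArithmeticFunction ArithmeticFunction.Moebius ArithmeticFunction.zeta
  Chebyshev

namespace Literature.NumberTheory.Sieve.Vinogradov

open Vaughan (cU gU fU arith_sub_apply vonMangoldt_eq_four_terms abs_cU_le_log cU_eq_zero_of_lt gU_eq_zero_of_le abs_gU_le fU_apply abs_fU_le sum_sq_card_divisors_le log_le_log_of_le sum_Ioc_mul_two_pow_eq_sum)

/-! ### `S(α)` as an `afExpSum` -/

/-- `S(α) = ∑_{n ≤ N} Λ(n) e(nα)` is `afExpSum Λ`. [folklore] -/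
theorem primeExpSum_eq_afExpSum (N : ℕ) (α : ℝ) :
    Literature.NumberTheory.Sieve.primeExpSum N α = afExpSum (fun n => Λ n) N α := rfl

/-! ### The Vaughan decomposition (Nathanson, Lemma 8.5) -/

/-- **Vaughan's decomposition of `S(α)`** (Nathanson, Lemma 8.5, from Vaughan's identity in the
regrouped form `Literature.NumberTheory.Sieve.Vaughan.vonMangoldt_eq_four_terms`,
`Λ = Λ_u + μ_u * log - c_u * 1 + F_u * G_u` with `c_u = μ_u * Λ_u`, `G_u = (μ - μ_u) * 1`,
`F_u = Λ - Λ_u`): `S(α) = ∑_{n ≤ N} Λ(n) e(nα) = T₀ + S₁ - S₂ + S₄` with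
`T₀ = ∑ Λ_u(n) e(nα)`, `S₁ = ∑ (μ_u * log)(n) e(nα)`, `S₂ = ∑ (c_u * 1)(n) e(nα)`,
`S₄ = ∑ (G_u * F_u)(n) e(nα)` (`= -S₃` in Nathanson's notation).
[cite: Nathanson1996, §8.5, Lemma 8.5] -/
theorem primeExpSum_eq_vaughan (u N : ℕ) (α : ℝ) :
    Literature.NumberTheory.Sieve.primeExpSum N α =
      afExpSum (⇑(Literature.NumberTheory.Sieve.vonMangoldtTrunc u)) N α +
      afExpSum (⇑((Literature.NumberTheory.Sieve.moebiusTrunc u : ArithmeticFunction ℝ) * ArithmeticFunction.log)) N α -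
      afExpSum (⇑(cU u * (ζ : ArithmeticFunction ℝ))) N α +
      afExpSum (⇑(gU u * fU u)) N α := by
  have hV := vonMangoldt_eq_four_terms u
  rw [mul_comm (fU u) (gU u)] at hV
  unfold Literature.NumberTheory.Sieve.primeExpSum afExpSum
  rw [← Finset.sum_add_distrib, ← Finset.sum_sub_distrib, ← Finset.sum_add_distrib]
  refine Finset.sum_congr rfl fun n _ => ?_
  have h := congrArg (fun F : ArithmeticFunction ℝ => F n) hV
  simp only [ArithmeticFunction.add_apply, arith_sub_apply] at h
  rw [h]
  push_cast
  ring

/-! ### The four pieces -/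

section Pieces

variable {α : ℝ} {a : ℤ} {q : ℕ}

/-- `|∑_{n ≤ N} Λ_V(n) e(nα)| ≤ ψ(V)`. [folklore] -/
theorem norm_afExpSum_vonMangoldtTrunc_le (V N : ℕ) (α : ℝ) :
    ‖afExpSum (⇑(Literature.NumberTheory.Sieve.vonMangoldtTrunc V)) N α‖ ≤ ψ V := by
  refine (norm_afExpSum_le _ N α).trans ?_
  have h1 : ∑ n ∈ Icc 1 N, |Literature.NumberTheory.Sieve.vonMangoldtTrunc V n| =
      ∑ n ∈ (Icc 1 N).filter (fun n => n ≤ V), Λ n := by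
    rw [Finset.sum_filter]
    refine Finset.sum_congr rfl fun n _ => ?_
    rw [Literature.NumberTheory.Sieve.vonMangoldtTrunc_apply]
    split_ifs
    · exact abs_of_nonneg ArithmeticFunction.vonMangoldt_nonneg
    · simp
  rw [h1, Chebyshev.psi, Nat.floor_natCast]
  refine Finset.sum_le_sum_of_subset_of_nonneg (fun n hn => ?_)
    fun _ _ _ => ArithmeticFunction.vonMangoldt_nonneg
  simp only [Finset.mem_filter, Finset.mem_Icc, Finset.mem_Ioc] at hn ⊢
  omega

/-- The truncated Möbius function has absolute value `≤ 1` and vanishes beyond `U`. [folklore] -/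
theorem abs_moebiusTrunc_le (U d : ℕ) :
    |((Literature.NumberTheory.Sieve.moebiusTrunc U : ArithmeticFunction ℝ) d)| ≤ if d ≤ U then 1 else 0 := by
  rw [ArithmeticFunction.intCoe_apply, Literature.NumberTheory.Sieve.moebiusTrunc_apply]
  split_ifs
  · exact_mod_cast ArithmeticFunction.abs_moebius_le_one
  · simp

/-- **Nathanson, Lemma 8.6** (type I sum `S₁`), explicit form: for `|α - a/q| ≤ q⁻²`,
`(a, q) = 1`, `1 ≤ q`, `1 ≤ U ≤ N`,
`|S₁| = |∑_{d ≤ U} μ(d) ∑_{r ≤ N/d} (log r) e(αdr)| ≤ 8 log N (N/q + U + q)(1 + log (qU))`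
(partial summation `norm_sum_log_mul_fourierChar_le` and Lemma 4.10 `sum_geomBound_div_le`).
[cite: Nathanson1996, §8.5, Lemma 8.6] -/
theorem norm_S1_le (hq : 1 ≤ q) (hcop : IsCoprime a q) (hα : |α - a / q| ≤ 1 / (q : ℝ) ^ 2)
    {U N : ℕ} (hU : 1 ≤ U) (hUN : U ≤ N) :
    ‖afExpSum (⇑((Literature.NumberTheory.Sieve.moebiusTrunc U : ArithmeticFunction ℝ) * ArithmeticFunction.log)) N α‖ ≤
      8 * Real.log N * (N / q + U + q) * (1 + Real.log (q * U)) := by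
  have hN0 : (0 : ℝ) ≤ N := Nat.cast_nonneg N
  have hlogN : 0 ≤ Real.log N := Real.log_natCast_nonneg N
  rw [afExpSum_mul]
  refine (norm_sum_le _ _).trans ?_
  -- termwise bound
  have hterm : ∀ d ∈ Icc 1 N,
      ‖((Literature.NumberTheory.Sieve.moebiusTrunc U : ArithmeticFunction ℝ) d : ℂ) *
          ∑ m ∈ Icc 1 (N / d), ((ArithmeticFunction.log m : ℝ) : ℂ) *
            (𝐞 ((m : ℝ) * (α * d)) : ℂ)‖ ≤
        (if d ≤ U then 1 else 0) * (2 * Real.log N * geomBound (N / d) (α * d)) := by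
    intro d hd
    have hd1 : (1 : ℝ) ≤ d := by exact_mod_cast (Finset.mem_Icc.mp hd).1
    rw [norm_mul, Complex.norm_real, Real.norm_eq_abs]
    refine mul_le_mul (abs_moebiusTrunc_le U d) ?_ (norm_nonneg _) (by positivity)
    simp only [ArithmeticFunction.log_apply]
    have hMV : ((N / d : ℕ) : ℝ) ≤ (N : ℝ) / d := Nat.cast_div_le
    refine (norm_sum_log_mul_fourierChar_le hMV (α * d)).trans ?_
    have hG : 0 ≤ geomBound ((N : ℝ) / d) (α * d) := geomBound_nonneg (by positivity) _
    have hlog : Real.log ((N / d : ℕ) : ℝ) ≤ Real.log N := log_le_log_of_le (Nat.div_le_self N d)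
    nlinarith
  refine (Finset.sum_le_sum hterm).trans ?_
  simp only [boole_mul]
  rw [← Finset.sum_filter, show (Icc 1 N).filter (fun d => d ≤ U) = Icc 1 U by
    ext d; simp only [Finset.mem_filter, Finset.mem_Icc]; omega]
  rw [← Finset.mul_sum]
  have hL := sum_geomBound_div_le hq hcop hα hN0 hU
  have h8 : 2 * Real.log N * ∑ k ∈ Icc 1 U, geomBound (N / k) (α * k) ≤
      2 * Real.log N * (4 * (N / q + U + q) * (1 + Real.log (q * U))) :=
    mul_le_mul_of_nonneg_left hL (by positivity)
  linarith

/-- **Nathanson, Lemma 8.7** (type I sum `S₂`), explicit form: for `|α - a/q| ≤ q⁻²`,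
`(a, q) = 1`, `1 ≤ q`, `u ≥ 1`,
`|S₂| = |∑_{k ≤ u²} c_u(k) ∑_{m ≤ N/k} e(αkm)| ≤ 4 log N (N/q + u² + q)(1 + log (qu²))`
(`|c_u(k)| ≤ log k ≤ log N`, `c_u(k) = 0` for `k > u²`, `Literature.NumberTheory.Sieve.Vaughan.abs_cU_le_log`,
`cU_eq_zero_of_lt`, and Lemma 4.10). [cite: Nathanson1996, §8.5, Lemma 8.7] -/
theorem norm_S2_le (hq : 1 ≤ q) (hcop : IsCoprime a q) (hα : |α - a / q| ≤ 1 / (q : ℝ) ^ 2)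
    {u : ℕ} (hu : 1 ≤ u) (N : ℕ) :
    ‖afExpSum (⇑(cU u * (ζ : ArithmeticFunction ℝ))) N α‖ ≤
      4 * Real.log N * (N / q + (u * u : ℕ) + q) * (1 + Real.log (q * (u * u : ℕ))) := by
  have hN0 : (0 : ℝ) ≤ N := Nat.cast_nonneg N
  have hlogN : 0 ≤ Real.log N := Real.log_natCast_nonneg N
  have huu : 1 ≤ u * u := Nat.mul_le_mul hu hu
  rw [afExpSum_mul]
  refine (norm_sum_le _ _).trans ?_
  have hterm : ∀ k ∈ Icc 1 N,
      ‖((cU u k : ℝ) : ℂ) * ∑ m ∈ Icc 1 (N / k), ((ζ : ArithmeticFunction ℝ) m : ℂ) *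
            (𝐞 ((m : ℝ) * (α * k)) : ℂ)‖ ≤
        (if k ≤ u * u then 1 else 0) * (Real.log N * geomBound (N / k) (α * k)) := by
    intro k hk
    have hk1 := (Finset.mem_Icc.mp hk).1
    have hkN := (Finset.mem_Icc.mp hk).2
    rw [norm_mul, Complex.norm_real, Real.norm_eq_abs]
    have hin : ∑ m ∈ Icc 1 (N / k), ((ζ : ArithmeticFunction ℝ) m : ℂ) *
        (𝐞 ((m : ℝ) * (α * k)) : ℂ) = ∑ m ∈ Icc 1 (N / k), (𝐞 ((m : ℝ) * (α * k)) : ℂ) := by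
      refine Finset.sum_congr rfl fun m hm => ?_
      have hm1 : m ≠ 0 := by have := (Finset.mem_Icc.mp hm).1; omega
      rw [ArithmeticFunction.natCoe_apply, ArithmeticFunction.zeta_apply_ne hm1]
      simp
    rw [hin]
    have hgeo : ‖∑ m ∈ Icc 1 (N / k), (𝐞 ((m : ℝ) * (α * k)) : ℂ)‖ ≤ geomBound (N / k) (α * k) :=
      norm_sum_Icc_fourierChar_le_geomBound _ Nat.cast_div_le
    have hG : 0 ≤ geomBound ((N : ℝ) / k) (α * k) := geomBound_nonneg (by positivity) _
    split_ifs with hkuu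
    · have hlogk : Real.log k ≤ Real.log N :=
        Real.log_le_log (by exact_mod_cast hk1) (by exact_mod_cast hkN)
      rw [one_mul]
      calc _ ≤ Real.log k * geomBound (N / k) (α * k) :=
            mul_le_mul (abs_cU_le_log u k) hgeo (norm_nonneg _) (Real.log_natCast_nonneg k)
        _ ≤ Real.log N * geomBound (N / k) (α * k) := mul_le_mul_of_nonneg_right hlogk hG
    · rw [cU_eq_zero_of_lt (not_le.mp hkuu)]; simp
  refine (Finset.sum_le_sum hterm).trans ?_
  simp only [boole_mul]
  rw [← Finset.sum_filter]
  have hsub : (Icc 1 N).filter (fun k => k ≤ u * u) ⊆ Icc 1 (u * u) := by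
    intro k hk
    simp only [Finset.mem_filter, Finset.mem_Icc] at hk ⊢
    omega
  have hmono : ∑ k ∈ (Icc 1 N).filter (fun k => k ≤ u * u), Real.log N * geomBound (N / k) (α * k)
      ≤ ∑ k ∈ Icc 1 (u * u), Real.log N * geomBound (N / k) (α * k) :=
    Finset.sum_le_sum_of_subset_of_nonneg hsub fun k _ _ =>
      mul_nonneg hlogN (geomBound_nonneg (by positivity) _)
  refine hmono.trans ?_
  rw [← Finset.mul_sum]
  have hL := sum_geomBound_div_le hq hcop hα hN0 huu
  have h4 : Real.log N * ∑ k ∈ Icc 1 (u * u), geomBound (N / k) (α * k) ≤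
      Real.log N * (4 * (N / q + (u * u : ℕ) + q) * (1 + Real.log (q * (u * u : ℕ)))) :=
    mul_le_mul_of_nonneg_left hL hlogN
  linarith

end Pieces

/-! ### The type II sum (Nathanson, Lemma 8.8) -/

section TypeII

variable {α : ℝ} {a : ℤ} {q : ℕ}

/-- `‖∑ c(ℓ) z(ℓ)‖² = ∑_ℓ ∑_m c(ℓ) c(m) Re (z(ℓ) conj z(m))` for real coefficients `c`.
[folklore] -/
theorem norm_sq_sum_real_mul (s : Finset ℕ) (c : ℕ → ℝ) (z : ℕ → ℂ) :
    ‖∑ ℓ ∈ s, (c ℓ : ℂ) * z ℓ‖ ^ 2 =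
      ∑ ℓ ∈ s, ∑ m ∈ s, c ℓ * c m * (z ℓ * (starRingEnd ℂ) (z m)).re := by
  have key : ∀ w : ℂ, ‖w‖ ^ 2 = (w * (starRingEnd ℂ) w).re := fun w => by
    rw [Complex.mul_conj, Complex.ofReal_re, Complex.normSq_eq_norm_sq]
  rw [key, map_sum, Finset.sum_mul_sum, Complex.re_sum]
  refine Finset.sum_congr rfl fun ℓ _ => ?_
  rw [Complex.re_sum]
  refine Finset.sum_congr rfl fun m _ => ?_
  rw [map_mul, Complex.conj_ofReal]
  have : (c ℓ : ℂ) * z ℓ * ((c m : ℂ) * (starRingEnd ℂ) (z m)) =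
      ((c ℓ * c m : ℝ) : ℂ) * (z ℓ * (starRingEnd ℂ) (z m)) := by push_cast; ring
  rw [this, Complex.re_ofReal_mul]

/-- **Mean square of type II sums over a dyadic block** (the second factor of (8.5) in
Nathanson's proof of Lemma 8.8, §8.5, in explicit form and with the diagonal kept): if
`|α - a/q| ≤ q⁻²`, `(a, q) = 1`, `q ≥ 1`, `K ≥ 1` and `|c(ℓ)| ≤ B`, then
`∑_{K < k ≤ 2K} |∑_{ℓ ≤ N/k} c(ℓ) e(αkℓ)|² ≤ B² (N + 8 (N/K)(N/q + N/K + q)(1 + log (qN)))`.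
Proof: expand the squares, interchange (`k` runs over an interval of length `≤ K` for fixed
`ℓ, m ≤ N/K`), bound the inner geometric sum by `min (K, 1/(2‖α(ℓ - m)‖))` (Lemma 4.7), and sum
over `j = ℓ - m` with Lemma 4.10. [cite: Nathanson1996, §8.5, proof of Lemma 8.8] -/
theorem typeII_sum_norm_sq_le (hq : 1 ≤ q) (hcop : IsCoprime a q)
    (hα : |α - a / q| ≤ 1 / (q : ℝ) ^ 2) {N K : ℕ} (hK : 1 ≤ K) {c : ℕ → ℝ} {B : ℝ}
    (hB : 0 ≤ B) (hc : ∀ ℓ, ℓ ≤ N → |c ℓ| ≤ B) :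
    ∑ k ∈ Ioc K (2 * K), ‖∑ ℓ ∈ Icc 1 (N / k), (c ℓ : ℂ) * (𝐞 ((ℓ : ℝ) * (α * k)) : ℂ)‖ ^ 2 ≤
      B ^ 2 * (N + 8 * ((N : ℝ) / K) * (N / q + N / K + q) * (1 + Real.log (q * N))) := by
  set M := N / K with hM
  have hK0 : (0 : ℝ) < K := by exact_mod_cast hK
  have hKr : (0 : ℝ) ≤ K := hK0.le
  have hN0 : (0 : ℝ) ≤ N := Nat.cast_nonneg N
  have hq0 : (0 : ℝ) < q := by exact_mod_cast hq
  have hG0 : ∀ y, 0 ≤ geomBound (K : ℝ) y := fun y => geomBound_nonneg hKr y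
  -- Step 1: rewrite each inner sum over `Icc 1 M` with indicator coefficients
  have hT : ∀ k ∈ Ioc K (2 * K), ∑ ℓ ∈ Icc 1 (N / k), (c ℓ : ℂ) * (𝐞 ((ℓ : ℝ) * (α * k)) : ℂ) =
      ∑ ℓ ∈ Icc 1 M, ((if k * ℓ ≤ N then c ℓ else 0 : ℝ) : ℂ) * (𝐞 ((ℓ : ℝ) * (α * k)) : ℂ) := by
    intro k hk
    have hKk : K < k := (Finset.mem_Ioc.mp hk).1
    have hk0 : 0 < k := lt_of_le_of_lt (Nat.zero_le K) hKk
    have hfilter : (Icc 1 M).filter (fun ℓ => k * ℓ ≤ N) = Icc 1 (N / k) := by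
      ext ℓ
      simp only [Finset.mem_filter, Finset.mem_Icc, hM]
      constructor
      · rintro ⟨⟨h1, _⟩, h2⟩
        exact ⟨h1, (Nat.le_div_iff_mul_le hk0).mpr (by rw [mul_comm]; exact h2)⟩
      · rintro ⟨h1, h2⟩
        have h3 : ℓ * k ≤ N := (Nat.le_div_iff_mul_le hk0).mp h2
        exact ⟨⟨h1, le_trans h2 (Nat.div_le_div_left hKk.le hK)⟩, by rw [mul_comm]; exact h3⟩
    rw [← hfilter, Finset.sum_filter]
    refine Finset.sum_congr rfl fun ℓ _ => ?_
    split_ifs <;> simp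
  -- Step 2: expand the squares
  have hexp : ∀ k ∈ Ioc K (2 * K),
      ‖∑ ℓ ∈ Icc 1 (N / k), (c ℓ : ℂ) * (𝐞 ((ℓ : ℝ) * (α * k)) : ℂ)‖ ^ 2 =
        ∑ ℓ ∈ Icc 1 M, ∑ m ∈ Icc 1 M,
          (if k * ℓ ≤ N then c ℓ else 0) * (if k * m ≤ N then c m else 0) *
            ((𝐞 ((k : ℝ) * (((ℓ : ℝ) - m) * α)) : ℂ)).re := by
    intro k hk
    rw [hT k hk, norm_sq_sum_real_mul]
    refine Finset.sum_congr rfl fun ℓ _ => Finset.sum_congr rfl fun m _ => ?_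
    congr 2
    rw [Circle.starRingEnd_addChar, ← Circle.coe_mul, ← AddChar.map_add_eq_mul]
    congr 2; ring
  -- Step 3: for fixed `ℓ, m` the sum over `k` is a geometric sum of length `≤ K`
  have hstep3 : ∀ ℓ ∈ Icc 1 M, ∀ m ∈ Icc 1 M,
      ∑ k ∈ Ioc K (2 * K), (if k * ℓ ≤ N then c ℓ else 0) * (if k * m ≤ N then c m else 0) *
          ((𝐞 ((k : ℝ) * (((ℓ : ℝ) - m) * α)) : ℂ)).re ≤
        B ^ 2 * geomBound K (((ℓ : ℝ) - m) * α) := by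
    intro ℓ hℓ m hm
    have hℓ0 : 0 < ℓ := (Finset.mem_Icc.mp hℓ).1
    have hm0 : 0 < m := (Finset.mem_Icc.mp hm).1
    have hℓN : ℓ ≤ N := le_trans (Finset.mem_Icc.mp hℓ).2 (Nat.div_le_self N K)
    have hmN : m ≤ N := le_trans (Finset.mem_Icc.mp hm).2 (Nat.div_le_self N K)
    set y : ℝ := ((ℓ : ℝ) - m) * α with hy
    have hite : ∀ k : ℕ, (if k * ℓ ≤ N then c ℓ else 0) * (if k * m ≤ N then c m else 0) *
        ((𝐞 ((k : ℝ) * y) : ℂ)).re =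
        if k * ℓ ≤ N ∧ k * m ≤ N then c ℓ * c m * ((𝐞 ((k : ℝ) * y) : ℂ)).re else 0 := by
      intro k
      by_cases h1 : k * ℓ ≤ N <;> by_cases h2 : k * m ≤ N <;> simp [h1, h2]
    simp_rw [hite]
    rw [← Finset.sum_filter]
    have hfil : (Ioc K (2 * K)).filter (fun k => k * ℓ ≤ N ∧ k * m ≤ N) =
        Ioc K (min (2 * K) (min (N / ℓ) (N / m))) := by
      ext k
      simp only [Finset.mem_filter, Finset.mem_Ioc, le_min_iff, Nat.le_div_iff_mul_le hℓ0,
        Nat.le_div_iff_mul_le hm0]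
      tauto
    rw [hfil, ← Finset.mul_sum, ← Complex.re_sum]
    set b := min (2 * K) (min (N / ℓ) (N / m)) with hb
    have hlen : ((b - K : ℕ) : ℝ) ≤ K := by
      have : b - K ≤ K := by omega
      exact_mod_cast this
    have hgeo := norm_sum_Ioc_fourierChar_le_geomBound y hlen
    calc c ℓ * c m * (∑ k ∈ Ioc K b, (𝐞 ((k : ℝ) * y) : ℂ)).re
        ≤ |c ℓ * c m * (∑ k ∈ Ioc K b, (𝐞 ((k : ℝ) * y) : ℂ)).re| := le_abs_self _
      _ = |c ℓ| * |c m| * |(∑ k ∈ Ioc K b, (𝐞 ((k : ℝ) * y) : ℂ)).re| := by rw [abs_mul, abs_mul]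
      _ ≤ B * B * geomBound K y := by
          refine mul_le_mul (mul_le_mul (hc ℓ hℓN) (hc m hmN) (abs_nonneg _) hB)
            ((Complex.abs_re_le_norm _).trans hgeo) (abs_nonneg _) (by positivity)
      _ = B ^ 2 * geomBound K y := by ring
  -- Step 4: sum over `m` for fixed `ℓ`, via `j = ℓ - m` and `j = m - ℓ`
  have hstep4 : ∀ ℓ ∈ Icc 1 M, ∑ m ∈ Icc 1 M, geomBound K (((ℓ : ℝ) - m) * α) ≤
      K + 2 * ∑ j ∈ Icc 1 M, geomBound K (α * j) := by
    intro ℓ hℓ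
    have hℓM : ℓ ≤ M := (Finset.mem_Icc.mp hℓ).2
    rw [← Finset.sum_filter_add_sum_filter_not (Icc 1 M) (fun m => m ≤ ℓ)]
    have hA : ∑ m ∈ (Icc 1 M).filter (fun m => m ≤ ℓ), geomBound K (((ℓ : ℝ) - m) * α) ≤
        K + ∑ j ∈ Icc 1 M, geomBound K (α * j) := by
      have h1 : ∑ m ∈ (Icc 1 M).filter (fun m => m ≤ ℓ), geomBound K (((ℓ : ℝ) - m) * α) =
          ∑ m ∈ (Icc 1 M).filter (fun m => m ≤ ℓ), geomBound K (α * ((ℓ - m : ℕ) : ℝ)) := by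
        refine Finset.sum_congr rfl fun m hm => ?_
        have hml : m ≤ ℓ := (Finset.mem_filter.mp hm).2
        rw [Nat.cast_sub hml, mul_comm]
      have hinj : ∀ x ∈ (Icc 1 M).filter (fun m => m ≤ ℓ),
          ∀ y ∈ (Icc 1 M).filter (fun m => m ≤ ℓ), ℓ - x = ℓ - y → x = y := by
        intro x hx y hy hxy
        have := (Finset.mem_filter.mp hx).2
        have := (Finset.mem_filter.mp hy).2
        omega
      rw [h1, ← Finset.sum_image (f := fun j : ℕ => geomBound (K : ℝ) (α * j)) hinj]
      have hsub : ((Icc 1 M).filter (fun m => m ≤ ℓ)).image (fun m => ℓ - m) ⊆ Icc 0 M := by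
        intro j hj
        obtain ⟨m, hm, rfl⟩ := Finset.mem_image.mp hj
        simp only [Finset.mem_Icc, Finset.mem_filter] at hm ⊢
        omega
      refine (Finset.sum_le_sum_of_subset_of_nonneg hsub fun j _ _ => hG0 _).trans ?_
      rw [← Finset.add_sum_erase _ _ (Finset.mem_Icc.mpr ⟨le_rfl, Nat.zero_le M⟩ : 0 ∈ Icc 0 M)]
      have hdiff : (Icc 0 M).erase 0 = Icc 1 M := by
        ext j
        simp only [Finset.mem_erase, Finset.mem_Icc]
        omega
      rw [hdiff]
      simp [geomBound_zero]
    have hBs : ∑ m ∈ (Icc 1 M).filter (fun m => ¬ m ≤ ℓ), geomBound K (((ℓ : ℝ) - m) * α) ≤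
        ∑ j ∈ Icc 1 M, geomBound K (α * j) := by
      have h1 : ∑ m ∈ (Icc 1 M).filter (fun m => ¬ m ≤ ℓ), geomBound K (((ℓ : ℝ) - m) * α) =
          ∑ m ∈ (Icc 1 M).filter (fun m => ¬ m ≤ ℓ), geomBound K (α * ((m - ℓ : ℕ) : ℝ)) := by
        refine Finset.sum_congr rfl fun m hm => ?_
        have hml : ℓ ≤ m := by have := (Finset.mem_filter.mp hm).2; omega
        rw [Nat.cast_sub hml, ← geomBound_neg]
        congr 1; ring
      have hinj : ∀ x ∈ (Icc 1 M).filter (fun m => ¬ m ≤ ℓ),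
          ∀ y ∈ (Icc 1 M).filter (fun m => ¬ m ≤ ℓ), x - ℓ = y - ℓ → x = y := by
        intro x hx y hy hxy
        have := (Finset.mem_filter.mp hx).2
        have := (Finset.mem_filter.mp hy).2
        omega
      rw [h1, ← Finset.sum_image (f := fun j : ℕ => geomBound (K : ℝ) (α * j)) hinj]
      refine Finset.sum_le_sum_of_subset_of_nonneg (fun j hj => ?_) fun j _ _ => hG0 _
      obtain ⟨m, hm, rfl⟩ := Finset.mem_image.mp hj
      simp only [Finset.mem_Icc, Finset.mem_filter] at hm ⊢
      omega
    linarith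
  -- Step 5: assemble
  have hMle : (M : ℝ) ≤ N / K := Nat.cast_div_le
  have hMK : (M : ℝ) * K ≤ N := by rwa [← le_div_iff₀ hK0]
  calc ∑ k ∈ Ioc K (2 * K), ‖∑ ℓ ∈ Icc 1 (N / k), (c ℓ : ℂ) * (𝐞 ((ℓ : ℝ) * (α * k)) : ℂ)‖ ^ 2
      = ∑ ℓ ∈ Icc 1 M, ∑ m ∈ Icc 1 M, ∑ k ∈ Ioc K (2 * K),
          (if k * ℓ ≤ N then c ℓ else 0) * (if k * m ≤ N then c m else 0) *
            ((𝐞 ((k : ℝ) * (((ℓ : ℝ) - m) * α)) : ℂ)).re := by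
        rw [Finset.sum_congr rfl hexp, Finset.sum_comm]
        exact Finset.sum_congr rfl fun ℓ _ => Finset.sum_comm
    _ ≤ ∑ ℓ ∈ Icc 1 M, ∑ m ∈ Icc 1 M, B ^ 2 * geomBound K (((ℓ : ℝ) - m) * α) :=
        Finset.sum_le_sum fun ℓ hℓ => Finset.sum_le_sum fun m hm => hstep3 ℓ hℓ m hm
    _ ≤ ∑ _ℓ ∈ Icc 1 M, B ^ 2 * (K + 2 * ∑ j ∈ Icc 1 M, geomBound K (α * j)) := by
        refine Finset.sum_le_sum fun ℓ hℓ => ?_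
        rw [← Finset.mul_sum]
        exact mul_le_mul_of_nonneg_left (hstep4 ℓ hℓ) (sq_nonneg B)
    _ = B ^ 2 * (M * (K + 2 * ∑ j ∈ Icc 1 M, geomBound K (α * j))) := by
        rw [Finset.sum_const, Nat.card_Icc, Nat.add_sub_cancel, nsmul_eq_mul]; ring
    _ ≤ B ^ 2 * (N + 8 * ((N : ℝ) / K) * (N / q + N / K + q) * (1 + Real.log (q * N))) := by
        refine mul_le_mul_of_nonneg_left ?_ (sq_nonneg B)
        rcases Nat.eq_zero_or_pos M with hM0 | hMpos
        · rw [hM0]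
          simp only [Nat.cast_zero, zero_mul]
          have : 0 ≤ 1 + Real.log (q * N) := by
            rcases Nat.eq_zero_or_pos N with hN | hN
            · simp [hN]
            · have : (1 : ℝ) ≤ q * N := by
                have h1 : (1 : ℝ) ≤ q := by exact_mod_cast hq
                have h2 : (1 : ℝ) ≤ N := by exact_mod_cast hN
                nlinarith
              have := Real.log_nonneg this
              linarith
          positivity
        · have hj : ∑ j ∈ Icc 1 M, geomBound K (α * j) ≤
              ∑ j ∈ Icc 1 M, geomBound (N / j) (α * j) := by
            refine Finset.sum_le_sum fun j hj => geomBound_mono ?_ _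
            obtain ⟨hj1, hjM⟩ := Finset.mem_Icc.mp hj
            have hj0 : (0 : ℝ) < j := by exact_mod_cast hj1
            rw [le_div_iff₀ hj0]
            have : (j : ℝ) ≤ M := by exact_mod_cast hjM
            nlinarith
          have hL := sum_geomBound_div_le hq hcop hα hN0 hMpos
          have hMr : (1 : ℝ) ≤ M := by exact_mod_cast hMpos
          have hq1 : (1 : ℝ) ≤ q := by exact_mod_cast hq
          have hMN : (M : ℝ) ≤ N := by exact_mod_cast Nat.div_le_self N K
          have hlogM : Real.log (q * M) ≤ Real.log (q * N) :=
            Real.log_le_log (by positivity) (mul_le_mul_of_nonneg_left hMN hq0.le)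
          have hlog0 : 0 ≤ 1 + Real.log (q * M) := by
            have := Real.log_nonneg (by nlinarith : (1 : ℝ) ≤ q * M); linarith
          have hlog1 : 0 ≤ 1 + Real.log (q * N) := le_trans hlog0 (by linarith)
          have hS : ∑ j ∈ Icc 1 M, geomBound K (α * j) ≤
              4 * (N / q + M + q) * (1 + Real.log (q * N)) := by
            refine (hj.trans hL).trans ?_
            exact mul_le_mul_of_nonneg_left (by linarith) (by positivity)
          have hS0 : 0 ≤ ∑ j ∈ Icc 1 M, geomBound K (α * j) :=
            Finset.sum_nonneg fun j _ => hG0 _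
          have hM0' : (0 : ℝ) ≤ M := by positivity
          have h2 : (M : ℝ) * (4 * (N / q + M + q) * (1 + Real.log (q * N))) ≤
              (N / K) * (4 * (N / q + N / K + q) * (1 + Real.log (q * N))) := by
            apply mul_le_mul hMle _ (by positivity) (by positivity)
            apply mul_le_mul_of_nonneg_right _ hlog1
            linarith
          nlinarith [mul_le_mul_of_nonneg_left hS hM0']

end TypeII

/-! ### Type II coefficients and dyadic blocks -/

section TypeIIBlocks

variable {α : ℝ} {a : ℤ} {q : ℕ}

/-- `|F_u(ℓ)| ≤ log N` for `ℓ ≤ N` (`F_u = Λ - Λ_u`, `Literature.NumberTheory.Sieve.Vaughan.fU`). [folklore] -/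
theorem abs_fU_le_log {u ℓ N : ℕ} (hℓ : ℓ ≤ N) : |fU u ℓ| ≤ Real.log N := by
  refine (abs_fU_le u ℓ).trans (ArithmeticFunction.vonMangoldt_le_log.trans ?_)
  exact log_le_log_of_le hℓ

/-- **Cauchy–Schwarz on a dyadic block** ((8.5) in Nathanson's proof of Lemma 8.8, §8.5):
`|∑_{K < k ≤ 2K} G(k) T(k)| ≤ (∑_{k ≤ 2K} d(k)²)^{1/2} (∑_{K < k ≤ 2K} |T(k)|²)^{1/2}`, combined
with `Literature.NumberTheory.Sieve.Vaughan.sum_sq_card_divisors_le` (`|G_u| ≤ d`, `Literature.NumberTheory.Sieve.Vaughan.abs_gU_le`) and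
`typeII_sum_norm_sq_le` (here `T(k) = ∑_{ℓ ≤ N/k} F_u(ℓ) e(αkℓ)`, `|F_u| ≤ log N`).
[cite: Nathanson1996, §8.5, proof of Lemma 8.8] -/
theorem typeII_block_le_sqrt (hq : 1 ≤ q) (hcop : IsCoprime a q)
    (hα : |α - a / q| ≤ 1 / (q : ℝ) ^ 2) {N K : ℕ} (hK : 1 ≤ K) (u : ℕ) :
    ‖∑ k ∈ Ioc K (2 * K), (gU u k : ℂ) *
        ∑ ℓ ∈ Icc 1 (N / k), (fU u ℓ : ℂ) * (𝐞 ((ℓ : ℝ) * (α * k)) : ℂ)‖ ≤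
      Real.sqrt (2 * K * (1 + Real.log (2 * K : ℕ)) ^ 3) *
        Real.sqrt (Real.log N ^ 2 *
          (N + 8 * ((N : ℝ) / K) * (N / q + N / K + q) * (1 + Real.log (q * N)))) := by
  set G : ℕ → ℝ := fun k => gU u k with hGdef
  set T : ℕ → ℂ := fun k => ∑ ℓ ∈ Icc 1 (N / k), (fU u ℓ : ℂ) * (𝐞 ((ℓ : ℝ) * (α * k)) : ℂ)
    with hTdef
  show ‖∑ k ∈ Ioc K (2 * K), (G k : ℂ) * T k‖ ≤ _
  have h1 : ‖∑ k ∈ Ioc K (2 * K), (G k : ℂ) * T k‖ ≤ ∑ k ∈ Ioc K (2 * K), |G k| * ‖T k‖ := by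
    refine (norm_sum_le _ _).trans (le_of_eq (Finset.sum_congr rfl fun k _ => ?_))
    rw [norm_mul, Complex.norm_real, Real.norm_eq_abs]
  have hCS := Finset.sum_mul_sq_le_sq_mul_sq (Ioc K (2 * K)) (fun k => |G k|) (fun k => ‖T k‖)
  have hA : ∑ k ∈ Ioc K (2 * K), |G k| ^ 2 ≤ 2 * K * (1 + Real.log (2 * K : ℕ)) ^ 3 := by
    calc ∑ k ∈ Ioc K (2 * K), |G k| ^ 2
        ≤ ∑ k ∈ Ioc K (2 * K), ((k.divisors.card : ℕ) : ℝ) ^ 2 := by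
          refine Finset.sum_le_sum fun k _ => pow_le_pow_left₀ (abs_nonneg _) ?_ 2
          have h := abs_gU_le u k
          rw [ArithmeticFunction.sigma_zero_apply] at h
          exact h
      _ ≤ ∑ k ∈ Ioc 0 (2 * K), ((k.divisors.card : ℕ) : ℝ) ^ 2 :=
          Finset.sum_le_sum_of_subset_of_nonneg (Finset.Ioc_subset_Ioc_left (Nat.zero_le K))
            fun _ _ _ => sq_nonneg _
      _ ≤ ((2 * K : ℕ) : ℝ) * (1 + Real.log (2 * K : ℕ)) ^ 3 := sum_sq_card_divisors_le (2 * K)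
      _ = 2 * K * (1 + Real.log (2 * K : ℕ)) ^ 3 := by push_cast; ring
  have hB : ∑ k ∈ Ioc K (2 * K), ‖T k‖ ^ 2 ≤ Real.log N ^ 2 *
      (N + 8 * ((N : ℝ) / K) * (N / q + N / K + q) * (1 + Real.log (q * N))) := by
    exact typeII_sum_norm_sq_le hq hcop hα hK (Real.log_natCast_nonneg N)
      fun ℓ hℓ => abs_fU_le_log hℓ
  have hS0 : 0 ≤ ∑ k ∈ Ioc K (2 * K), |G k| * ‖T k‖ :=
    Finset.sum_nonneg fun k _ => mul_nonneg (abs_nonneg _) (norm_nonneg _)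
  calc ‖∑ k ∈ Ioc K (2 * K), (G k : ℂ) * T k‖ ≤ ∑ k ∈ Ioc K (2 * K), |G k| * ‖T k‖ := h1
    _ = Real.sqrt ((∑ k ∈ Ioc K (2 * K), |G k| * ‖T k‖) ^ 2) := (Real.sqrt_sq hS0).symm
    _ ≤ Real.sqrt ((∑ k ∈ Ioc K (2 * K), |G k| ^ 2) * ∑ k ∈ Ioc K (2 * K), ‖T k‖ ^ 2) :=
        Real.sqrt_le_sqrt hCS
    _ ≤ Real.sqrt ((2 * K * (1 + Real.log (2 * K : ℕ)) ^ 3) * (Real.log N ^ 2 *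
          (N + 8 * ((N : ℝ) / K) * (N / q + N / K + q) * (1 + Real.log (q * N))))) := by
        refine Real.sqrt_le_sqrt (mul_le_mul hA hB (Finset.sum_nonneg fun _ _ => sq_nonneg _) ?_)
        positivity
    _ = _ := Real.sqrt_mul (by positivity) _

/-- Numerical facts about `L = log N`, `N ≥ 2`: `1/2 < L`. [folklore] -/
theorem half_lt_log {N : ℕ} (hN : 2 ≤ N) : (1 : ℝ) / 2 < Real.log N := by
  have h2 : Real.log 2 ≤ Real.log N := Real.log_le_log (by norm_num) (by exact_mod_cast hN)
  have := Real.log_two_gt_d9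
  linarith

/-- The real-variable inequality behind `typeII_block_le`. [folklore] -/
theorem typeII_block_core {L K N q u P Q R l₁ l₂ : ℝ} (hL2 : 1 / 2 < L) (hK0 : 0 < K)
    (hN0 : 0 < N) (hq0 : 0 < q) (hu0 : 0 < u) (hKN : K ≤ N / u) (huK : u ≤ K)
    (hl₁0 : 0 ≤ l₁) (hl₁ : l₁ ≤ 4 * L) (hl₂0 : 0 ≤ l₂) (hl₂ : l₂ ≤ 4 * L)
    (hP0 : 0 ≤ P) (hQ0 : 0 ≤ Q) (hR0 : 0 ≤ R)
    (hP2 : P ^ 2 = N ^ 2 / q) (hQ2 : Q ^ 2 = N ^ 2 / u) (hR2 : R ^ 2 = N * q) :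
    (2 * K * l₁ ^ 3) * (L ^ 2 * (N + 8 * (N / K) * (N / q + N / K + q) * l₂)) ≤
      (64 * L ^ 3 * (P + 2 * Q + R)) ^ 2 := by
  have hL0 : 0 < L := by linarith
  have hX0 : (0 : ℝ) ≤ N / q + N / K + q := by positivity
  have hA1 : 2 * K * l₁ ^ 3 ≤ 128 * K * L ^ 3 := by
    have : l₁ ^ 3 ≤ (4 * L) ^ 3 := pow_le_pow_left₀ hl₁0 hl₁ 3
    calc 2 * K * l₁ ^ 3 ≤ 2 * K * (4 * L) ^ 3 := mul_le_mul_of_nonneg_left this (by positivity)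
      _ = 128 * K * L ^ 3 := by ring
  have hA2 : L ^ 2 * (N + 8 * (N / K) * (N / q + N / K + q) * l₂) ≤
      32 * L ^ 3 * (N + N / K * (N / q + N / K + q)) := by
    have h8 : (0 : ℝ) ≤ 8 * (N / K) * (N / q + N / K + q) := by positivity
    have h1 : N + 8 * (N / K) * (N / q + N / K + q) * l₂ ≤
        N + 8 * (N / K) * (N / q + N / K + q) * (4 * L) := by
      have := mul_le_mul_of_nonneg_left hl₂ h8
      linarith
    have h2 : N ≤ 2 * L * N := le_mul_of_one_le_left hN0.le (by linarith)
    calc L ^ 2 * (N + 8 * (N / K) * (N / q + N / K + q) * l₂)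
        ≤ L ^ 2 * (N + 8 * (N / K) * (N / q + N / K + q) * (4 * L)) :=
          mul_le_mul_of_nonneg_left h1 (by positivity)
      _ ≤ L ^ 2 * (2 * L * N + 8 * (N / K) * (N / q + N / K + q) * (4 * L)) := by
          apply mul_le_mul_of_nonneg_left _ (by positivity); linarith
      _ = 32 * L ^ 3 * (N / 16 + N / K * (N / q + N / K + q)) := by ring
      _ ≤ 32 * L ^ 3 * (N + N / K * (N / q + N / K + q)) := by
          apply mul_le_mul_of_nonneg_left _ (by positivity)
          linarith
  have hKX : K * (N + N / K * (N / q + N / K + q)) = K * N + (N ^ 2 / q + N ^ 2 / K + N * q) := by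
    field_simp
  have hKN2 : K * N ≤ N ^ 2 / u := by
    calc K * N ≤ N / u * N := mul_le_mul_of_nonneg_right hKN hN0.le
      _ = N ^ 2 / u := by ring
  have hNK2 : N ^ 2 / K ≤ N ^ 2 / u := div_le_div_of_nonneg_left (by positivity) hu0 huK
  have hA20 : 0 ≤ L ^ 2 * (N + 8 * (N / K) * (N / q + N / K + q) * l₂) := by positivity
  have hsq : P ^ 2 + 2 * Q ^ 2 + R ^ 2 ≤ (P + 2 * Q + R) ^ 2 := by
    have e : (P + 2 * Q + R) ^ 2 =
        P ^ 2 + 2 * Q ^ 2 + R ^ 2 + (2 * Q ^ 2 + 4 * (P * Q) + 2 * (P * R) + 4 * (Q * R)) := by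
      ring
    rw [e]
    have := mul_nonneg hP0 hQ0
    have := mul_nonneg hP0 hR0
    have := mul_nonneg hQ0 hR0
    have := sq_nonneg Q
    linarith
  calc (2 * K * l₁ ^ 3) * (L ^ 2 * (N + 8 * (N / K) * (N / q + N / K + q) * l₂))
      ≤ (128 * K * L ^ 3) * (32 * L ^ 3 * (N + N / K * (N / q + N / K + q))) :=
        mul_le_mul hA1 hA2 hA20 (by positivity)
    _ = 4096 * L ^ 6 * (K * (N + N / K * (N / q + N / K + q))) := by ring
    _ = 4096 * L ^ 6 * (K * N + (N ^ 2 / q + N ^ 2 / K + N * q)) := by rw [hKX]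
    _ ≤ 4096 * L ^ 6 * (N ^ 2 / u + (N ^ 2 / q + N ^ 2 / u + N * q)) := by
        apply mul_le_mul_of_nonneg_left _ (by positivity); linarith
    _ = 4096 * L ^ 6 * (P ^ 2 + 2 * Q ^ 2 + R ^ 2) := by rw [hP2, hQ2, hR2]; ring
    _ ≤ 4096 * L ^ 6 * (P + 2 * Q + R) ^ 2 := mul_le_mul_of_nonneg_left hsq (by positivity)
    _ = (64 * L ^ 3 * (P + 2 * Q + R)) ^ 2 := by ring

/-- **Uniform bound for a dyadic block** `u ≤ K ≤ N/u` of the type II sum (Nathanson, proof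
of Lemma 8.8: `|S_{3,i}| ≪ N (log N)³ (q^{-1/2} + N^{-1/5} + q^{1/2} N^{-1/2})` for `u = N^{2/5}`),
explicit form: `≤ 64 (log N)³ (N/√q + 2N/√u + √N √q)`.
[cite: Nathanson1996, §8.5, proof of Lemma 8.8] -/
theorem typeII_block_le (hq : 1 ≤ q) (hcop : IsCoprime a q)
    (hα : |α - a / q| ≤ 1 / (q : ℝ) ^ 2) {N K u : ℕ} (hN : 2 ≤ N) (hqN : q ≤ N) (hu : 1 ≤ u)
    (huK : u ≤ K) (hKu : K * u ≤ N) :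
    ‖∑ k ∈ Ioc K (2 * K), (gU u k : ℂ) *
        ∑ ℓ ∈ Icc 1 (N / k), (fU u ℓ : ℂ) * (𝐞 ((ℓ : ℝ) * (α * k)) : ℂ)‖ ≤
      64 * Real.log N ^ 3 * (N / Real.sqrt q + 2 * (N / Real.sqrt u) + Real.sqrt N * Real.sqrt q) := by
  have hK : 1 ≤ K := le_trans hu huK
  refine (typeII_block_le_sqrt hq hcop hα hK u).trans ?_
  have hL2 : 1 / 2 < Real.log N := half_lt_log hN
  have hlogN2 : Real.log 2 ≤ Real.log N := Real.log_le_log (by norm_num) (by exact_mod_cast hN)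
  have hlog2' := Real.log_two_gt_d9
  have hN0 : (0 : ℝ) < N := by exact_mod_cast (lt_of_lt_of_le (by norm_num) hN)
  have hN1 : (1 : ℝ) ≤ N := by exact_mod_cast (le_trans (by norm_num) hN)
  have hq0 : (0 : ℝ) < q := by exact_mod_cast hq
  have hq1 : (1 : ℝ) ≤ q := by exact_mod_cast hq
  have hK0 : (0 : ℝ) < K := by exact_mod_cast hK
  have hu0 : (0 : ℝ) < u := by exact_mod_cast hu
  have hKN : (K : ℝ) ≤ N / u := by
    rw [le_div_iff₀ hu0]; exact_mod_cast hKu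
  have hKN' : (K : ℝ) ≤ N := le_trans hKN (div_le_self hN0.le (by exact_mod_cast hu))
  have huK' : (u : ℝ) ≤ K := by exact_mod_cast huK
  have hlog2K : 1 + Real.log (2 * K : ℕ) ≤ 4 * Real.log N := by
    have h1 : Real.log (2 * K : ℕ) ≤ Real.log 2 + Real.log N := by
      rw [← Real.log_mul (by norm_num) hN0.ne']
      exact Real.log_le_log (by positivity) (by push_cast; linarith)
    linarith
  have hlog2K0 : 0 ≤ 1 + Real.log (2 * K : ℕ) := by
    have := Real.log_natCast_nonneg (2 * K); linarith
  have hlogqN : 1 + Real.log (q * N) ≤ 4 * Real.log N := by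
    have h1 : Real.log (q * N) ≤ Real.log N + Real.log N := by
      rw [← Real.log_mul hN0.ne' hN0.ne']
      exact Real.log_le_log (by positivity)
        (mul_le_mul_of_nonneg_right (by exact_mod_cast hqN) hN0.le)
    linarith
  have hlogqN0 : 0 ≤ 1 + Real.log (q * N) := by
    have := Real.log_nonneg (one_le_mul_of_one_le_of_one_le hq1 hN1); linarith
  have hP2 : ((N : ℝ) / Real.sqrt q) ^ 2 = (N : ℝ) ^ 2 / q := by
    rw [div_pow, Real.sq_sqrt hq0.le]
  have hQ2 : ((N : ℝ) / Real.sqrt u) ^ 2 = (N : ℝ) ^ 2 / u := by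
    rw [div_pow, Real.sq_sqrt hu0.le]
  have hR2 : (Real.sqrt N * Real.sqrt q) ^ 2 = (N : ℝ) * q := by
    rw [mul_pow, Real.sq_sqrt hN0.le, Real.sq_sqrt hq0.le]
  have hcore := typeII_block_core hL2 hK0 hN0 hq0 hu0 hKN huK' hlog2K0 hlog2K hlogqN0 hlogqN
    (by positivity) (by positivity) (by positivity) hP2 hQ2 hR2
  have hD0 : 0 ≤ 64 * Real.log N ^ 3 *
      (N / Real.sqrt q + 2 * (N / Real.sqrt u) + Real.sqrt N * Real.sqrt q) := by positivity
  rw [← Real.sqrt_mul (by positivity), ← Real.sqrt_sq hD0]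
  refine Real.sqrt_le_sqrt ?_
  convert hcore using 2

/-- Dyadic decomposition of a sum supported on `(u, N]`:
`∑_{k ≤ N} f(k) = ∑_{i < h} ∑_{u2^i < k ≤ 2u2^i} f(k)` when `N ≤ u 2^h`, `f = 0` on `[1, u]`
and beyond `N` (`Literature.NumberTheory.Sieve.Vaughan.sum_Ioc_mul_two_pow_eq_sum` for the dyadic part). [folklore] -/
theorem sum_Icc_eq_sum_dyadic {N u h : ℕ} (hh : N ≤ u * 2 ^ h) (f : ℕ → ℂ)
    (hf0 : ∀ k ≤ u, f k = 0) (hfN : ∀ k, N < k → f k = 0) :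
    ∑ k ∈ Icc 1 N, f k =
      ∑ i ∈ range h, ∑ k ∈ Ioc (u * 2 ^ i) (u * 2 ^ i + u * 2 ^ i), f k := by
  have h1 : ∑ k ∈ Icc 1 N, f k = ∑ k ∈ Ioc 0 (u * 2 ^ h), f k := by
    apply Finset.sum_subset
    · intro k hk
      simp only [Finset.mem_Icc, Finset.mem_Ioc] at hk ⊢; omega
    · intro k hk hk'
      simp only [Finset.mem_Icc, Finset.mem_Ioc, not_and, not_le] at hk hk'
      exact hfN k (by omega)
  have hu2 : u ≤ u * 2 ^ h := Nat.le_mul_of_pos_right u (Nat.two_pow_pos h)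
  rw [h1, ← Finset.sum_Ioc_consecutive f (Nat.zero_le u) hu2,
    Finset.sum_eq_zero (fun k hk => hf0 k (Finset.mem_Ioc.mp hk).2), zero_add,
    sum_Ioc_mul_two_pow_eq_sum]

/-- **Nathanson, Lemma 8.8** (the type II sum `S₃ = -S₄`), explicit form: for `|α - a/q| ≤ q⁻²`,
`(a, q) = 1`, `1 ≤ q ≤ N`, `2 ≤ N`, `1 ≤ u ≤ N`,
`|S₄| = |∑_{k > u} G_u(k) ∑_{u < ℓ ≤ N/k} Λ(ℓ) e(αkℓ)| ≤ 256 (log N)⁴ (N/√q + 2N/√u + √N √q)`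
(`G_u(k) = ∑_{d ∣ k, d > u} μ(d)`): dyadic blocks `(u2^i, u2^{i+1}]`, `i ≤ log₂ N`, each bounded
by `typeII_block_le` (blocks with `u 2^i > N/u` vanish). [cite: Nathanson1996, §8.5, Lemma 8.8] -/
theorem norm_S4_le (hq : 1 ≤ q) (hcop : IsCoprime a q) (hα : |α - a / q| ≤ 1 / (q : ℝ) ^ 2)
    {N u : ℕ} (hN : 2 ≤ N) (hqN : q ≤ N) (hu : 1 ≤ u) :
    ‖afExpSum (⇑(gU u * fU u)) N α‖ ≤
      256 * Real.log N ^ 4 *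
        (N / Real.sqrt q + 2 * (N / Real.sqrt u) + Real.sqrt N * Real.sqrt q) := by
  rw [afExpSum_mul]
  set h := Nat.log 2 N + 1 with hh
  have hN0 : N ≠ 0 := by omega
  have hNh : N ≤ u * 2 ^ h := by
    have h1 : N < 2 ^ h := Nat.lt_pow_succ_log_self (by norm_num) N
    have h2 : 2 ^ h ≤ u * 2 ^ h := Nat.le_mul_of_pos_left _ hu
    omega
  set D : ℝ := 64 * Real.log N ^ 3 *
    (N / Real.sqrt q + 2 * (N / Real.sqrt u) + Real.sqrt N * Real.sqrt q) with hD
  have hlogN : 0 ≤ Real.log N := Real.log_natCast_nonneg N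
  have hD0 : 0 ≤ D := by positivity
  rw [sum_Icc_eq_sum_dyadic hNh _ ?hf0 ?hfN]
  case hf0 =>
    intro k hk
    rw [gU_eq_zero_of_le hk]; simp
  case hfN =>
    intro k hk
    have : N / k = 0 := Nat.div_eq_of_lt hk
    rw [this]; simp
  refine (norm_sum_le _ _).trans ?_
  have hblock : ∀ i ∈ range h,
      ‖∑ k ∈ Ioc (u * 2 ^ i) (u * 2 ^ i + u * 2 ^ i), (gU u k : ℂ) *
          ∑ ℓ ∈ Icc 1 (N / k), (fU u ℓ : ℂ) * (𝐞 ((ℓ : ℝ) * (α * k)) : ℂ)‖ ≤ D := by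
    intro i _
    set K := u * 2 ^ i with hK
    rw [← two_mul K]
    have huK : u ≤ K := Nat.le_mul_of_pos_right u (Nat.two_pow_pos i)
    by_cases hKu : K * u ≤ N
    · exact typeII_block_le hq hcop hα hN hqN hu huK hKu
    · rw [Finset.sum_eq_zero]
      · simpa using hD0
      intro k hk
      have hKk : K < k := (Finset.mem_Ioc.mp hk).1
      have hk0 : 0 < k := by omega
      have hNk : N / k < u := by
        rw [Nat.div_lt_iff_lt_mul hk0]
        calc N < K * u := not_le.mp hKu
          _ ≤ u * k := by rw [mul_comm]; exact Nat.mul_le_mul_left u hKk.le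
      have hT : ∑ ℓ ∈ Icc 1 (N / k), (fU u ℓ : ℂ) * (𝐞 ((ℓ : ℝ) * (α * k)) : ℂ) = 0 := by
        refine Finset.sum_eq_zero fun ℓ hℓ => ?_
        have hℓu : ℓ ≤ u := by have := (Finset.mem_Icc.mp hℓ).2; omega
        rw [fU_apply, if_pos hℓu]; simp
      rw [hT, mul_zero]
  refine (Finset.sum_le_sum hblock).trans ?_
  rw [Finset.sum_const, Finset.card_range, nsmul_eq_mul]
  -- `h ≤ 4 log N`
  have hL2 : 1 / 2 < Real.log N := half_lt_log hN
  have hlog2 := Real.log_two_gt_d9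
  have hhL : (h : ℝ) ≤ 4 * Real.log N := by
    have h1 : ((Nat.log 2 N : ℕ) : ℝ) * Real.log 2 ≤ Real.log N := by
      rw [← Real.log_pow]
      apply Real.log_le_log (by positivity)
      exact_mod_cast Nat.pow_log_le_self 2 hN0
    have h2 : ((Nat.log 2 N : ℕ) : ℝ) ≤ 2 * Real.log N := by
      by_contra hc
      have hc' := not_le.mp hc
      have : 2 * Real.log N * Real.log 2 < ((Nat.log 2 N : ℕ) : ℝ) * Real.log 2 :=
        mul_lt_mul_of_pos_right hc' (by linarith)
      nlinarith
    rw [hh]; push_cast; linarith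
  calc (h : ℝ) * D ≤ 4 * Real.log N * D := mul_le_mul_of_nonneg_right hhL hD0
    _ = _ := by rw [hD]; ring

end TypeIIBlocks

/-! ### Assembly: Theorem 8.5 -/

section Assembly

variable {α : ℝ} {a : ℤ} {q : ℕ}

/-- The real-variable bookkeeping behind `norm_primeExpSum_le_of_param`. [folklore] -/
theorem assembly_core {L u A B P Q R T₀ T₁ T₂ T₄ : ℝ} (hL2 : 1 / 2 < L) (hu : 1 ≤ u)
    (hA : 0 ≤ A) (hAP : A ≤ P) (hB : 0 ≤ B) (hBR : B ≤ R)
    (h₀ : T₀ ≤ 6 * u) (h₁ : T₁ ≤ 32 * L ^ 2 * (A + u + B)) (h₂ : T₂ ≤ 20 * L ^ 2 * (A + u ^ 2 + B))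
    (h₄ : T₄ ≤ 256 * L ^ 4 * (P + 2 * Q + R)) :
    T₀ + T₁ + T₂ + T₄ ≤ 512 * L ^ 4 * (P + R + u ^ 2 + Q) := by
  have hP : 0 ≤ P := le_trans hA hAP
  have hR : 0 ≤ R := le_trans hB hBR
  have h2L : 1 ≤ 2 * L := by linarith
  have hL0 : 0 ≤ L := by linarith
  have hL2sq : 1 ≤ 4 * L ^ 2 := by nlinarith
  have hL4 : L ^ 2 ≤ 4 * L ^ 4 := by nlinarith [sq_nonneg L]
  have h16 : 1 ≤ 16 * L ^ 4 := by nlinarith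
  have huu : u ≤ u ^ 2 := by nlinarith
  have hu0 : 0 ≤ u := by linarith
  have hsum1 : A + u + B ≤ P + u ^ 2 + R := by linarith
  have hsum0 : 0 ≤ A + u + B := by linarith
  have hsum2 : A + u ^ 2 + B ≤ P + u ^ 2 + R := by linarith
  have hS1 : 32 * L ^ 2 * (A + u + B) ≤ 128 * L ^ 4 * (P + u ^ 2 + R) :=
    mul_le_mul (by linarith) hsum1 hsum0 (by positivity)
  have hS2 : 20 * L ^ 2 * (A + u ^ 2 + B) ≤ 80 * L ^ 4 * (P + u ^ 2 + R) :=
    mul_le_mul (by linarith) hsum2 (by positivity) (by positivity)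
  have hT0 : 6 * u ≤ 96 * L ^ 4 * u ^ 2 := by
    calc 6 * u ≤ 6 * u ^ 2 := by linarith
      _ = 6 * 1 * u ^ 2 := by ring
      _ ≤ 6 * (16 * L ^ 4) * u ^ 2 := by gcongr
      _ = 96 * L ^ 4 * u ^ 2 := by ring
  have hL4P : 0 ≤ L ^ 4 * P := by positivity
  have hL4R : 0 ≤ L ^ 4 * R := by positivity
  have hL4u : 0 ≤ L ^ 4 * u ^ 2 := by positivity
  nlinarith

/-- **Vinogradov's bound with a free parameter** `u` (Nathanson's proof of Theorem 8.5 with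
`N^{2/5}` replaced by `u`): for `|α - a/q| ≤ q⁻²`, `(a, q) = 1`, `1 ≤ q ≤ N`, `2 ≤ N`, `1 ≤ u ≤ N`,
`|∑_{n ≤ N} Λ(n) e(nα)| ≤ 512 (log N)⁴ (N/√q + √N √q + u² + N/√u)`, by `primeExpSum_eq_vaughan`
and the four bounds `norm_afExpSum_vonMangoldtTrunc_le` (with Chebyshev's `ψ(u) ≤ 6u`),
`norm_S1_le`, `norm_S2_le`, `norm_S4_le`. [cite: Nathanson1996, §8.5, proof of Theorem 8.5] -/
theorem norm_primeExpSum_le_of_param (hq : 1 ≤ q) (hcop : IsCoprime a q)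
    (hα : |α - a / q| ≤ 1 / (q : ℝ) ^ 2) {N u : ℕ} (hN : 2 ≤ N) (hqN : q ≤ N) (hu : 1 ≤ u)
    (huN : u ≤ N) :
    ‖Literature.NumberTheory.Sieve.primeExpSum N α‖ ≤ 512 * Real.log N ^ 4 *
      (N / Real.sqrt q + Real.sqrt N * Real.sqrt q + (u : ℝ) ^ 2 + N / Real.sqrt u) := by
  rw [primeExpSum_eq_vaughan u N α]
  have hT0 := norm_afExpSum_vonMangoldtTrunc_le u N α
  have hS1 := norm_S1_le hq hcop hα hu huN
  have hS2 := norm_S2_le hq hcop hα hu N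
  have hS4 := norm_S4_le hq hcop hα hN hqN hu
  have hL2 : 1 / 2 < Real.log N := half_lt_log hN
  have hlog2 := Real.log_two_gt_d9
  have hlog2' := Real.log_two_lt_d9
  have hN0 : (0 : ℝ) < N := by exact_mod_cast (lt_of_lt_of_le (by norm_num) hN)
  have hN1 : (1 : ℝ) ≤ N := by exact_mod_cast (le_trans (by norm_num) hN)
  have hq0 : (0 : ℝ) < q := by exact_mod_cast hq
  have hq1 : (1 : ℝ) ≤ q := by exact_mod_cast hq
  have hu0 : (0 : ℝ) < u := by exact_mod_cast hu
  have hu1 : (1 : ℝ) ≤ u := by exact_mod_cast hu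
  have huN' : (u : ℝ) ≤ N := by exact_mod_cast huN
  have hqN' : (q : ℝ) ≤ N := by exact_mod_cast hqN
  have hlogN : 0 ≤ Real.log N := by linarith
  -- `ψ(u) ≤ 6u`
  have hpsi : ψ u ≤ 6 * u := by
    have h := Chebyshev.psi_le_const_mul_self hu0.le
    have h4 : Real.log 4 = 2 * Real.log 2 := by
      rw [show (4 : ℝ) = 2 ^ 2 by norm_num, Real.log_pow]; ring
    rw [h4] at h
    nlinarith
  -- logarithms of the auxiliary quantities
  have hlogqu : 1 + Real.log (q * u) ≤ 4 * Real.log N := by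
    have h1 : Real.log (q * u) ≤ Real.log N + Real.log N := by
      rw [← Real.log_mul hN0.ne' hN0.ne']
      exact Real.log_le_log (by positivity) (mul_le_mul hqN' huN' hu0.le hN0.le)
    linarith
  have hlogquu : 1 + Real.log (q * ((u * u : ℕ) : ℝ)) ≤ 5 * Real.log N := by
    have h1 : Real.log (q * ((u * u : ℕ) : ℝ)) ≤ Real.log N + Real.log N + Real.log N := by
      rw [← Real.log_mul hN0.ne' hN0.ne', ← Real.log_mul (by positivity) hN0.ne']
      refine Real.log_le_log (by positivity) ?_
      push_cast
      have := mul_le_mul hqN' huN' hu0.le hN0.le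
      calc (q : ℝ) * (u * u) = q * u * u := by ring
        _ ≤ N * N * N := mul_le_mul this huN' hu0.le (by positivity)
    linarith
  have hX1 : (0 : ℝ) ≤ N / q + u + q := by positivity
  have hX2 : (0 : ℝ) ≤ N / q + ((u * u : ℕ) : ℝ) + q := by positivity
  have hS1' : ‖afExpSum (⇑((Literature.NumberTheory.Sieve.moebiusTrunc u : ArithmeticFunction ℝ) * ArithmeticFunction.log))
      N α‖ ≤ 32 * Real.log N ^ 2 * (N / q + u + q) := by
    refine hS1.trans ?_
    have := mul_le_mul_of_nonneg_left hlogqu (by positivity : 0 ≤ 8 * Real.log N * (N / q + u + q))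
    nlinarith
  have hS2' : ‖afExpSum (⇑(cU u * (ζ : ArithmeticFunction ℝ))) N α‖ ≤
      20 * Real.log N ^ 2 * (N / q + (u : ℝ) ^ 2 + q) := by
    refine hS2.trans ?_
    have := mul_le_mul_of_nonneg_left hlogquu
      (by positivity : 0 ≤ 4 * Real.log N * (N / q + ((u * u : ℕ) : ℝ) + q))
    have e : ((u * u : ℕ) : ℝ) = (u : ℝ) ^ 2 := by push_cast; ring
    rw [e] at this ⊢
    nlinarith
  -- comparison of the elementary quantities
  have hsqrt_q : Real.sqrt q ≤ q := by
    rw [Real.sqrt_le_left] <;> nlinarith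
  have hAP : (N : ℝ) / q ≤ N / Real.sqrt q :=
    div_le_div_of_nonneg_left hN0.le (Real.sqrt_pos.mpr hq0) hsqrt_q
  have hBR : (q : ℝ) ≤ Real.sqrt N * Real.sqrt q := by
    have h1 : Real.sqrt q ≤ Real.sqrt N := Real.sqrt_le_sqrt hqN'
    calc (q : ℝ) = Real.sqrt q * Real.sqrt q := (Real.mul_self_sqrt hq0.le).symm
      _ ≤ Real.sqrt N * Real.sqrt q := mul_le_mul_of_nonneg_right h1 (Real.sqrt_nonneg _)
  have hcore := assembly_core hL2 hu1 (by positivity) hAP hq0.le hBR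
    (hT0.trans hpsi) hS1' hS2' hS4
  refine le_trans ?_ hcore
  -- triangle inequality
  refine (norm_add_le _ _).trans (add_le_add ((norm_sub_le _ _).trans (add_le_add
    ((norm_add_le _ _).trans le_rfl) le_rfl)) le_rfl)

/-- Arithmetic of the choice `u = ⌊N^{2/5}⌋`: `1 ≤ u ≤ N`, `u² ≤ N^{4/5}` and
`N/√u ≤ 2 N^{4/5}`. [folklore] -/
theorem floor_rpow_two_fifths_bounds {N : ℕ} (hN : 1 ≤ N) :
    1 ≤ ⌊(N : ℝ) ^ (2 / 5 : ℝ)⌋₊ ∧ ⌊(N : ℝ) ^ (2 / 5 : ℝ)⌋₊ ≤ N ∧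
      ((⌊(N : ℝ) ^ (2 / 5 : ℝ)⌋₊ : ℕ) : ℝ) ^ 2 ≤ (N : ℝ) ^ (4 / 5 : ℝ) ∧
      (N : ℝ) / Real.sqrt ((⌊(N : ℝ) ^ (2 / 5 : ℝ)⌋₊ : ℕ) : ℝ) ≤ 2 * (N : ℝ) ^ (4 / 5 : ℝ) := by
  have hN1 : (1 : ℝ) ≤ N := by exact_mod_cast hN
  have hN0 : (0 : ℝ) < N := by linarith
  set x : ℝ := (N : ℝ) ^ (2 / 5 : ℝ) with hx
  have hx1 : 1 ≤ x := Real.one_le_rpow hN1 (by norm_num)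
  have hx0 : 0 < x := by linarith
  have hxN : x ≤ N := by
    calc x = (N : ℝ) ^ (2 / 5 : ℝ) := rfl
      _ ≤ (N : ℝ) ^ (1 : ℝ) := Real.rpow_le_rpow_of_exponent_le hN1 (by norm_num)
      _ = N := Real.rpow_one _
  have hu1 : 1 ≤ ⌊x⌋₊ := (Nat.one_le_floor_iff x).mpr hx1
  have huN : ⌊x⌋₊ ≤ N := by
    have := Nat.floor_le_floor hxN
    rwa [Nat.floor_natCast] at this
  have hule : ((⌊x⌋₊ : ℕ) : ℝ) ≤ x := Nat.floor_le hx0.le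
  have huge : x / 2 ≤ ((⌊x⌋₊ : ℕ) : ℝ) := by
    have h1 : x < ((⌊x⌋₊ : ℕ) : ℝ) + 1 := Nat.lt_floor_add_one x
    have h2 : (1 : ℝ) ≤ ((⌊x⌋₊ : ℕ) : ℝ) := by exact_mod_cast hu1
    linarith
  have hu0 : (0 : ℝ) < ((⌊x⌋₊ : ℕ) : ℝ) := by exact_mod_cast hu1
  have hx2 : x ^ 2 = (N : ℝ) ^ (4 / 5 : ℝ) := by
    rw [hx, ← Real.rpow_natCast, ← Real.rpow_mul hN0.le]; norm_num
  have h45 : 0 ≤ (N : ℝ) ^ (4 / 5 : ℝ) := Real.rpow_nonneg hN0.le _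
  refine ⟨hu1, huN, ?_, ?_⟩
  · rw [← hx2]
    exact pow_le_pow_left₀ hu0.le hule 2
  · -- compare squares
    have hsq : ((N : ℝ) / Real.sqrt ((⌊x⌋₊ : ℕ) : ℝ)) ^ 2 ≤ (2 * (N : ℝ) ^ (4 / 5 : ℝ)) ^ 2 := by
      rw [div_pow, Real.sq_sqrt hu0.le, mul_pow, ← hx2]
      -- N² / u ≤ 4 x²  ⟸  N² ≤ 2 x² · (x/2) ≤ ... ; use N² = x² · x² · x (N = x^{5/2})
      have hN2 : (N : ℝ) ^ 2 = x ^ 5 := by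
        rw [hx, ← Real.rpow_natCast ((N : ℝ) ^ (2 / 5 : ℝ)) 5, ← Real.rpow_mul hN0.le]
        norm_num
      rw [div_le_iff₀ hu0, hN2]
      have e : (2 : ℝ) ^ 2 * (x ^ 2) ^ 2 * (x / 2) = 2 * x ^ 5 := by ring
      have h5 := pow_pos hx0 5
      calc x ^ 5 ≤ 2 ^ 2 * (x ^ 2) ^ 2 * (x / 2) := by rw [e]; linarith
        _ ≤ 2 ^ 2 * (x ^ 2) ^ 2 * ((⌊x⌋₊ : ℕ) : ℝ) := by
            apply mul_le_mul_of_nonneg_left huge; positivity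
    exact (pow_le_pow_iff_left₀ (by positivity) (by positivity) two_ne_zero).mp hsq

/-- **Vinogradov's estimate for `S(α) = ∑_{n ≤ N} Λ(n) e(nα)`** (Nathanson, Theorem 8.5 for the
von Mangoldt-weighted sum): for `|α - a/q| ≤ q⁻²`, `(a, q) = 1`, `1 ≤ q ≤ N`, `2 ≤ N`,
`|S(α)| ≤ 1536 (N q^{-1/2} + N^{4/5} + N^{1/2} q^{1/2}) (log N)⁴`.
[cite: Nathanson1996, Theorem 8.5, p. 220] -/
theorem norm_primeExpSum_le (hq : 1 ≤ q) (hcop : IsCoprime a q)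
    (hα : |α - a / q| ≤ 1 / (q : ℝ) ^ 2) {N : ℕ} (hN : 2 ≤ N) (hqN : q ≤ N) :
    ‖Literature.NumberTheory.Sieve.primeExpSum N α‖ ≤ 1536 * ((N : ℝ) / Real.sqrt q + (N : ℝ) ^ (4 / 5 : ℝ) +
      Real.sqrt N * Real.sqrt q) * Real.log N ^ 4 := by
  obtain ⟨hu1, huN, hu2, hu3⟩ := floor_rpow_two_fifths_bounds (le_trans (by norm_num) hN)
  have h := norm_primeExpSum_le_of_param hq hcop hα hN hqN hu1 huN
  have hlogN : 0 ≤ Real.log N := Real.log_natCast_nonneg N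
  have hL4 : 0 ≤ Real.log N ^ 4 := by positivity
  refine h.trans ?_
  have hP : 0 ≤ (N : ℝ) / Real.sqrt q := by positivity
  have hR : 0 ≤ Real.sqrt N * Real.sqrt q := by positivity
  nlinarith [mul_le_mul_of_nonneg_left hu2 hL4, mul_le_mul_of_nonneg_left hu3 hL4,
    mul_nonneg hL4 hP, mul_nonneg hL4 hR]

/-- `F(α) - S(α)`: the prime powers `p^k`, `k ≥ 2`, contribute at most `ψ(N) - θ(N)`.
[folklore] -/
theorem norm_primeExpSumLog_sub_primeExpSum_le (N : ℕ) (α : ℝ) :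
    ‖Literature.NumberTheory.Sieve.primeExpSumLog N α - Literature.NumberTheory.Sieve.primeExpSum N α‖ ≤ ψ N - θ N := by
  have hsplit := Finset.sum_filter_add_sum_filter_not (Icc 1 N) (fun n : ℕ => n.Prime)
    (fun n : ℕ => (Λ n : ℂ) * (𝐞 ((n : ℝ) * α) : ℂ))
  have hF : Literature.NumberTheory.Sieve.primeExpSumLog N α =
      ∑ n ∈ (Icc 1 N).filter (fun n : ℕ => n.Prime), (Λ n : ℂ) * (𝐞 ((n : ℝ) * α) : ℂ) := by
    rw [Literature.NumberTheory.Sieve.primeExpSumLog, Nat.primesLE_eq_filter_Icc_one]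
    refine Finset.sum_congr rfl fun p hp => ?_
    rw [ArithmeticFunction.vonMangoldt_apply_prime (Finset.mem_filter.mp hp).2]
  have hdiff : Literature.NumberTheory.Sieve.primeExpSumLog N α - Literature.NumberTheory.Sieve.primeExpSum N α =
      -∑ n ∈ (Icc 1 N).filter (fun n : ℕ => ¬ n.Prime), (Λ n : ℂ) * (𝐞 ((n : ℝ) * α) : ℂ) := by
    rw [hF, Literature.NumberTheory.Sieve.primeExpSum, ← hsplit]; ring
  rw [hdiff, norm_neg, Chebyshev.psi_sub_theta_eq_sum_not_prime, Nat.floor_natCast]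
  have hI : Ioc 0 N = Icc 1 N := by ext n; simp only [Finset.mem_Ioc, Finset.mem_Icc]; omega
  rw [hI]
  refine (norm_sum_le _ _).trans (le_of_eq (Finset.sum_congr rfl fun n _ => ?_))
  rw [norm_mul, norm_fourierChar, mul_one, Complex.norm_real,
    Real.norm_of_nonneg ArithmeticFunction.vonMangoldt_nonneg]

/-- **Vinogradov's estimate for exponential sums over primes** (Nathanson, *Additive Number
Theory: the Classical Bases*, GTM 164, Theorem 8.5, p. 220), explicit form: there is an
absolute constant `C` (`= 1552`) such that for all `N ≥ 2`, all real `α` and all integers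
`a, q` with `1 ≤ q ≤ N`, `(a, q) = 1`, `|α - a/q| ≤ q⁻²`,
`|∑_{p ≤ N} (log p) e(pα)| ≤ C (N q^{-1/2} + N^{4/5} + N^{1/2} q^{1/2}) (log N)⁴`.
This is the statement of the named fact `Literature.NumberTheory.Sieve.MontgomeryVaughan1975.vinogradov_expSum_bound`
(Lemma 3.1 of Montgomery–Vaughan 1975). [cite: Nathanson1996, Theorem 8.5, p. 220] -/
theorem vinogradov_primeExpSumLog_bound :
    ∃ C : ℝ, ∀ (N : ℕ), 2 ≤ N → ∀ (α : ℝ) (a : ℤ) (q : ℕ), 1 ≤ q → q ≤ N →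
      IsCoprime a (q : ℤ) → |α - a / q| ≤ 1 / (q : ℝ) ^ 2 →
        ‖Literature.NumberTheory.Sieve.primeExpSumLog N α‖ ≤
          C * ((N : ℝ) / Real.sqrt q + (N : ℝ) ^ (4 / 5 : ℝ) + Real.sqrt N * Real.sqrt q) *
            Real.log N ^ 4 := by
  refine ⟨1552, fun N hN α a q hq hqN hcop hα => ?_⟩
  have hS := norm_primeExpSum_le hq hcop hα hN hqN
  have hD := norm_primeExpSumLog_sub_primeExpSum_le N α
  have hN1 : (1 : ℝ) ≤ N := by exact_mod_cast (le_trans (by norm_num) hN)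
  have hN0 : (0 : ℝ) < N := by linarith
  have hL2 : 1 / 2 < Real.log N := half_lt_log hN
  have hlogN : 0 ≤ Real.log N := by linarith
  have hpt : ψ N - θ N ≤ 2 * Real.sqrt N * Real.log N := Chebyshev.psi_sub_theta_le hN1
  have hsqrt : Real.sqrt N ≤ (N : ℝ) ^ (4 / 5 : ℝ) := by
    rw [Real.sqrt_eq_rpow]
    exact Real.rpow_le_rpow_of_exponent_le hN1 (by norm_num)
  have hL8 : Real.log N ≤ 8 * Real.log N ^ 4 := by
    have h2L : 1 ≤ 2 * Real.log N := by linarith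
    have h4 : 1 ≤ 4 * Real.log N ^ 2 := by nlinarith
    have h8 : 1 ≤ 8 * Real.log N ^ 3 := by nlinarith
    nlinarith
  have hP : 0 ≤ (N : ℝ) / Real.sqrt q := by positivity
  have hR : 0 ≤ Real.sqrt N * Real.sqrt q := by positivity
  have h45 : 0 ≤ (N : ℝ) ^ (4 / 5 : ℝ) := Real.rpow_nonneg hN0.le _
  have hFS : ‖Literature.NumberTheory.Sieve.primeExpSumLog N α‖ ≤ ‖Literature.NumberTheory.Sieve.primeExpSum N α‖ +
      ‖Literature.NumberTheory.Sieve.primeExpSumLog N α - Literature.NumberTheory.Sieve.primeExpSum N α‖ := by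
    have := norm_add_le (Literature.NumberTheory.Sieve.primeExpSum N α) (Literature.NumberTheory.Sieve.primeExpSumLog N α - Literature.NumberTheory.Sieve.primeExpSum N α)
    rwa [add_sub_cancel] at this
  have hE : ‖Literature.NumberTheory.Sieve.primeExpSumLog N α - Literature.NumberTheory.Sieve.primeExpSum N α‖ ≤ 16 * (N : ℝ) ^ (4 / 5 : ℝ) * Real.log N ^ 4 := by
    calc _ ≤ 2 * Real.sqrt N * Real.log N := hD.trans hpt
      _ ≤ 2 * (N : ℝ) ^ (4 / 5 : ℝ) * (8 * Real.log N ^ 4) :=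
          mul_le_mul (by linarith) hL8 hlogN (by positivity)
      _ = 16 * (N : ℝ) ^ (4 / 5 : ℝ) * Real.log N ^ 4 := by ring
  have hL4 : 0 ≤ Real.log N ^ 4 := by positivity
  nlinarith [mul_nonneg hL4 hP, mul_nonneg hL4 hR, mul_nonneg hL4 h45]

end Assembly

end Literature.NumberTheory.Sieve.Vinogradov
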